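import Mathlib
import Summits.ResolutionOfSingularities.ResolutionOfSingularities.Theorems.SyzygyFlatteningDefs
import HarnessLib

/-!
# The base-changed model `k(X)·B ⊆ K(X)` is a localisation of `B[X]`
(`stub_baseChange_isLocalization`)

Crux `HigherRankTermination` (stmt-ResolutionOfSingularities-17045), line `birth`, registered stub
`stub_baseChange_isLocalization` of the base-change line `(k, K) ↦ (k(X), K(X))`.

Setting. `k ⊆ K` are fields, `K(X) = RatFunc K`; `k'` is an abstract field mapped isomorphically
onto the subfield `k(X) = IntermediateField.adjoin k {X} ⊆ K(X)` (the range hypothesis);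
`B : Subalgebra k K` is a model and `E = Algebra.adjoin k' B ⊆ K(X)` is its base change `k(X)·B`.
The polynomial ring `B[X]` maps to `E` by `Polynomial.eval₂RingHom ψ XE` (`ψ : B → E` the
inclusion, `XE = X`), and `M ⊆ B[X]` is the image of the non-zero polynomials of `k[X]`.

Claim: along this map `E` is the localisation `M⁻¹ B[X]`, i.e. `IsLocalization M E`:
* `map_units` — a non-zero `G ∈ k[X]` goes to `G(X) ∈ k(X) \ {0}`, the image of a non-zero element
  of the field `k'`, whose inverse lies in the `k'`-algebra `E`;
* `surj` — by induction on `Algebra.adjoin`: a generator `b ∈ B` is `C b / 1`, a scalar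
  `c ∈ k' = k(X)` is `r(X) / s(X)` with `r, s ∈ k[X]` (`IntermediateField.mem_adjoin_simple_iff`),
  and fractions `f(X) / G(X)` (`f ∈ B[X]`, `0 ≠ G ∈ k[X]`) are closed under `+` and `*`;
* `exists_of_eq` — the composite `B[X] → E → K(X)` is `f ↦ f` (coefficients read in `K`), which
  is injective because `K[X] → K(X)` is, so the multiplier `1` works.

Sources: folklore (localisation and base change of polynomial rings, e.g. Matsumura 1987, §4).
-/

noncomputable section

-- single-problem summit: the doubled namespace component is forced
set_option linter.dupNamespace false

namespace Summit.ResolutionOfSingularities.ResolutionOfSingularities.Theorems.SyzygyFlattening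

open Polynomial

variable {k K k' : Type*} [Field k] [Field K] [Algebra k K] [Field k'] [Algebra k' (RatFunc K)]

/-- The composite `B[X] → E ⊆ K(X)` of the evaluation map `f ↦ f(X)` (coefficients pushed through
the inclusion `ψ : B → E`) with `E ⊆ K(X)` is `f ↦ f`, the coefficients now read in `K`.
[folklore] -/
theorem baseChangeIsLocalization_coe_eval₂RingHom (B : Subalgebra k K)
    (E : Subalgebra k' (RatFunc K)) (ψ : ↥B →+* ↥E) (XE : ↥E)
    (hψ : ∀ b : ↥B, (ψ b : RatFunc K) = algebraMap K (RatFunc K) b)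
    (hXE : (XE : RatFunc K) = RatFunc.X) (f : Polynomial ↥B) :
    ((Polynomial.eval₂RingHom ψ XE f : ↥E) : RatFunc K) =
      algebraMap (Polynomial K) (RatFunc K) (f.map (algebraMap ↥B K)) := by
  have h : E.val.toRingHom.comp (Polynomial.eval₂RingHom ψ XE) =
      (algebraMap (Polynomial K) (RatFunc K)).comp (Polynomial.mapRingHom (algebraMap ↥B K)) := by
    refine Polynomial.ringHom_ext (fun b => ?_) ?_
    · change ((Polynomial.eval₂RingHom ψ XE (C b) : ↥E) : RatFunc K) =
        algebraMap (Polynomial K) (RatFunc K) ((C b).map (algebraMap ↥B K))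
      rw [Polynomial.coe_eval₂RingHom, Polynomial.eval₂_C, hψ, Polynomial.map_C,
        RatFunc.algebraMap_C, ← RatFunc.algebraMap_eq_C]
      rfl
    · change ((Polynomial.eval₂RingHom ψ XE X : ↥E) : RatFunc K) =
        algebraMap (Polynomial K) (RatFunc K) ((X : Polynomial ↥B).map (algebraMap ↥B K))
      rw [Polynomial.coe_eval₂RingHom, Polynomial.eval₂_X, hXE, Polynomial.map_X,
        RatFunc.algebraMap_X]
  exact RingHom.congr_fun h f

/-- On (images of) `k`-polynomials the evaluation map `B[X] → E ⊆ K(X)` is `G ↦ G(X)`.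
[folklore] -/
theorem baseChangeIsLocalization_coe_eval₂RingHom_map (B : Subalgebra k K)
    (E : Subalgebra k' (RatFunc K)) (ψ : ↥B →+* ↥E) (XE : ↥E)
    (hψ : ∀ b : ↥B, (ψ b : RatFunc K) = algebraMap K (RatFunc K) b)
    (hXE : (XE : RatFunc K) = RatFunc.X) (G : Polynomial k) :
    ((Polynomial.eval₂RingHom ψ XE (G.map (algebraMap k ↥B)) : ↥E) : RatFunc K) =
      Polynomial.aeval (RatFunc.X : RatFunc K) G := by
  rw [baseChangeIsLocalization_coe_eval₂RingHom B E ψ XE hψ hXE, Polynomial.map_map,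
    ← IsScalarTower.algebraMap_eq k ↥B K, ← RatFunc.aeval_X_left_eq_algebraMap,
    Polynomial.aeval_map_algebraMap]

/-- `G(X) ≠ 0` in `K(X)` for a non-zero `G ∈ k[X]` (`X` is transcendental over `K ⊇ k`).
[folklore] -/
theorem baseChangeIsLocalization_aeval_X_ne_zero {G : Polynomial k} (hG : G ≠ 0) :
    Polynomial.aeval (RatFunc.X : RatFunc K) G ≠ 0 := by
  rw [← Polynomial.aeval_map_algebraMap K, RatFunc.aeval_X_left_eq_algebraMap]
  exact RatFunc.algebraMap_ne_zero ((Polynomial.map_ne_zero_iff (algebraMap k K).injective).mpr hG)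

/-- **STUB `stub_baseChange_isLocalization`.** The base-changed model `E = k(X)·B ⊆ K(X)` (the
`k(X)`-subalgebra generated by `B ⊆ K`) is the localisation of the polynomial ring `B[X]` (mapped
in by `ψ : B → E` and `X`) at the non-zero `k`-polynomials: they become units of `k(X) ⊆ E`,
every element of `E` is a `k(X)`-combination of elements of `B` (so a fraction `f(X) / G(X)` with
`f ∈ B[X]`, `0 ≠ G ∈ k[X]`), and `B[X] → K(X)` is injective (`X` is transcendental over `K`).
[folklore] -/
theorem stub_baseChange_isLocalization : ∀ (k K : Type) [Field k] [Field K] [Algebra k K],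
    ∀ (k' : Type) [Field k'] [Algebra k k'] [Algebra k' (RatFunc K)] [IsScalarTower k k' (RatFunc K)],
      Set.range (algebraMap k' (RatFunc K)) =
        ((IntermediateField.adjoin k {(RatFunc.X : RatFunc K)} : IntermediateField k (RatFunc K)) :
          Set (RatFunc K)) →
    ∀ (B : Subalgebra k K) (E : Subalgebra k' (RatFunc K)),
      E = Algebra.adjoin k' ((algebraMap K (RatFunc K)) '' (B : Set K)) →
    ∀ (ψ : ↥B →+* ↥E) (XE : ↥E),
      (∀ b : ↥B, (ψ b : RatFunc K) = algebraMap K (RatFunc K) b) → (XE : RatFunc K) = RatFunc.X →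
      @IsLocalization (Polynomial ↥B) _
        ((nonZeroDivisors (Polynomial k)).map (Polynomial.mapRingHom (algebraMap k ↥B)))
        ↥E _ (Polynomial.eval₂RingHom ψ XE).toAlgebra := by
  intro k K _ _ _ k' _ _ _ _ hrange B E hE ψ XE hψ hXE
  letI : Algebra (Polynomial ↥B) ↥E := (Polynomial.eval₂RingHom ψ XE).toAlgebra
  -- the structure map `B[X] → E`, read in `K(X)`
  have hval : ∀ f : Polynomial ↥B, ((algebraMap (Polynomial ↥B) ↥E f : ↥E) : RatFunc K) =
      algebraMap (Polynomial K) (RatFunc K) (f.map (algebraMap ↥B K)) :=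
    baseChangeIsLocalization_coe_eval₂RingHom B E ψ XE hψ hXE
  have hvalk : ∀ G : Polynomial k,
      ((algebraMap (Polynomial ↥B) ↥E (G.map (algebraMap k ↥B)) : ↥E) : RatFunc K) =
        Polynomial.aeval (RatFunc.X : RatFunc K) G :=
    baseChangeIsLocalization_coe_eval₂RingHom_map B E ψ XE hψ hXE
  -- `G(X)`, `G ∈ k[X]`, lies in `k(X)`, the range of `k'`
  have hmemk : ∀ G : Polynomial k, ∃ g : k',
      algebraMap k' (RatFunc K) g = Polynomial.aeval (RatFunc.X : RatFunc K) G := by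
    intro G
    change Polynomial.aeval (RatFunc.X : RatFunc K) G ∈ Set.range (algebraMap k' (RatFunc K))
    rw [hrange]
    exact IntermediateField.algebra_adjoin_le_adjoin k _ (Polynomial.aeval_mem_adjoin_singleton k _)
  -- non-zero `k`-polynomials become units of `E`
  have hunit : ∀ G : Polynomial k, G ≠ 0 →
      IsUnit (algebraMap (Polynomial ↥B) ↥E (G.map (algebraMap k ↥B))) := by
    intro G hG
    obtain ⟨g, hg⟩ := hmemk G
    have hg0 : g ≠ 0 := by
      rintro rfl
      exact baseChangeIsLocalization_aeval_X_ne_zero (K := K) hG (by rw [← hg, map_zero])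
    refine IsUnit.of_mul_eq_one (algebraMap k' ↥E g⁻¹) (Subtype.ext ?_)
    rw [Subalgebra.coe_mul, hvalk, Subalgebra.coe_algebraMap, ← hg, ← map_mul,
      mul_inv_cancel₀ hg0, map_one, Subalgebra.coe_one]
  exact
    { map_units := fun m => by
        obtain ⟨G, hG, hGm⟩ := Submonoid.mem_map.mp m.2
        rw [← hGm]
        exact hunit G (nonZeroDivisors.ne_zero hG)
      surj := fun y => by
        suffices h : ∀ z ∈ Algebra.adjoin k' ((algebraMap K (RatFunc K)) '' (B : Set K)),
            ∃ f : Polynomial ↥B, ∃ G : Polynomial k, G ≠ 0 ∧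
              z * ((algebraMap (Polynomial ↥B) ↥E (G.map (algebraMap k ↥B)) : ↥E) : RatFunc K) =
                ((algebraMap (Polynomial ↥B) ↥E f : ↥E) : RatFunc K) by
          obtain ⟨f, G, hG, h⟩ := h y (by rw [← hE]; exact y.2)
          exact ⟨(f, ⟨G.map (algebraMap k ↥B),
            Submonoid.mem_map_of_mem _ (mem_nonZeroDivisors_of_ne_zero hG)⟩), Subtype.ext h⟩
        intro z hz
        induction hz using Algebra.adjoin_induction with
        | mem x hx =>
          obtain ⟨b, hb, rfl⟩ := hx
          refine ⟨Polynomial.C ⟨b, hb⟩, 1, one_ne_zero, ?_⟩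
          rw [Polynomial.map_one, map_one, Subalgebra.coe_one, mul_one,
            RingHom.algebraMap_toAlgebra, Polynomial.coe_eval₂RingHom, Polynomial.eval₂_C, hψ]
        | algebraMap c =>
          obtain ⟨r, s, hrs⟩ :=
            (IntermediateField.mem_adjoin_simple_iff k (α := (RatFunc.X : RatFunc K))
              (algebraMap k' (RatFunc K) c)).mp (by
                change algebraMap k' (RatFunc K) c ∈
                  ((IntermediateField.adjoin k {(RatFunc.X : RatFunc K)} :
                    IntermediateField k (RatFunc K)) : Set (RatFunc K))
                rw [← hrange]
                exact ⟨c, rfl⟩)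
          by_cases hs : s = 0
          · refine ⟨0, 1, one_ne_zero, ?_⟩
            rw [hrs]
            simp only [hs, map_zero, div_zero, zero_mul, ZeroMemClass.coe_zero]
          · refine ⟨r.map (algebraMap k ↥B), s, hs, ?_⟩
            rw [hvalk, hvalk, hrs]
            exact div_mul_cancel₀ _ (baseChangeIsLocalization_aeval_X_ne_zero hs)
        | add x y _ _ hx hy =>
          obtain ⟨f₁, G₁, hG₁, h₁⟩ := hx
          obtain ⟨f₂, G₂, hG₂, h₂⟩ := hy
          refine ⟨f₁ * G₂.map (algebraMap k ↥B) + f₂ * G₁.map (algebraMap k ↥B), G₁ * G₂,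
            mul_ne_zero hG₁ hG₂, ?_⟩
          simp only [Polynomial.map_mul, map_mul, map_add, Subalgebra.coe_mul, Subalgebra.coe_add]
          linear_combination
            ((algebraMap (Polynomial ↥B) ↥E (G₂.map (algebraMap k ↥B)) : ↥E) : RatFunc K) * h₁ +
              ((algebraMap (Polynomial ↥B) ↥E (G₁.map (algebraMap k ↥B)) : ↥E) : RatFunc K) * h₂
        | mul x y _ _ hx hy =>
          obtain ⟨f₁, G₁, hG₁, h₁⟩ := hx
          obtain ⟨f₂, G₂, hG₂, h₂⟩ := hy
          refine ⟨f₁ * f₂, G₁ * G₂, mul_ne_zero hG₁ hG₂, ?_⟩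
          simp only [Polynomial.map_mul, map_mul, Subalgebra.coe_mul]
          linear_combination
            (y * ((algebraMap (Polynomial ↥B) ↥E (G₂.map (algebraMap k ↥B)) : ↥E) : RatFunc K)) *
                h₁ + ((algebraMap (Polynomial ↥B) ↥E f₁ : ↥E) : RatFunc K) * h₂
      exists_of_eq := fun {a b} hab => by
        refine ⟨1, ?_⟩
        have h := congrArg (fun e : ↥E => (e : RatFunc K)) hab
        simp only [hval] at h
        rw [Polynomial.map_injective (algebraMap ↥B K) Subtype.val_injective
          (IsFractionRing.injective (Polynomial K) (RatFunc K) h)] }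

end Summit.ResolutionOfSingularities.ResolutionOfSingularities.Theorems.SyzygyFlattening

end
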